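import Summits.AnomalousDissipation.AnomalousDissipation.Theses.PumpedMirror

/-!
# Weak duality on the mirror slab for `PumpedMirror.MirrorFloorTG` (stmt-AnomalousDissipation-15372)

Line `registered` (lead `prover-line-stmt-AnomalousDissipation-15372-c1-0`), the EXACTNESS half of the
line: the crux's certificate `(Φ₁, θ₁ ≤ 0)` on the mirror slab `Fix K ∩ {|u|² ≤ E}` bounds from below the
mean dissipation of every RELAXED STATIONARY K-STATISTIC of `NS_ν(f_TG)` below energy `E` (a Borel probability
measure on `H` carried by the slab, of finite mean enstrophy, annihilating every cylindrical Liouville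
functional, with integrable work and the one global mean energy inequality `ν∫‖∇u‖²dμ ≤ ∫(u,f_TG)dμ`).
Hence the line's open stub S3 `stub_mirrorLawsLoudTG` ("low-energy relaxed K-statistics of `f_TG` are loud")
is NECESSARY for the crux (`mirrorLawsLoudTG_of_mirrorFloorTG`, the registered statement verbatim); in
particular ONE quiet family of relaxed K-statistics along `ν_j → 0` at one level `E` refutes the crux. Proof: the floor holds `μ`-a.e.; integrate; the
Liouville identity kills the generator term; `θ₁ ≤ 0` and the energy inequality sign the energy channel away
(the relaxed-slab form of the landed `FloorCertificate/Negative/WeakDuality.floorFamily_le_ensembleDissipation`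
and of `TaylorCertificatesFloorCertificateDuality.floorFamily_le_ensembleDissipation_of_relaxed`).
Statements adapted from the crux strategist's typed census `Cruxes/MirrorFloorTG/StrategistCensusS1.lean`
§F, §H (planner-cstrat-stmt-AnomalousDissipation-15372-s1-0, 2026-08-17), restated over tree vocabulary only.

References: Foias–Manley–Rosa–Temam 2001, Ch. IV §1.2 (1.28)–(1.31); Rosa–Temam, arXiv:2010.06730, Thm 6.3–6.4
(weak duality for mean-value bounds); Tobasco–Goluskin–Doering, arXiv:1705.07096.
-/

noncomputable section

set_option linter.dupNamespace false

namespace Summit.AnomalousDissipation.AnomalousDissipation.Theorems.PumpedMirrorMirrorFloorTG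

open MeasureTheory Filter Topology UnitAddTorus
open scoped InnerProductSpace ENNReal NNReal
open Literature.Analysis.FunctionSpaces Literature.Analysis.FluidPDE
open Summit.AnomalousDissipation.AnomalousDissipation.Theses.PumpedMirror

/-- **Weak duality on a carrier.** If `θ ≤ 0` and the floor
`ε₀ ≤ ν‖∇u‖² + ⟨F_ν(u),Φ'(u)⟩ + 2θ((u,f) − ν‖∇u‖²)` holds at every finite-enstrophy state of
`S ∩ {|u|² ≤ E}`, then every probability measure carried by `S ∩ {|u|² ≤ E}` with finite mean enstrophy,
the Liouville identity for `Φ`, integrable work and the global energy inequality dissipates at least `ε₀`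
in the mean. [cite: FMRTTurbulence2001, Ch. IV §1.2 (1.28)–(1.31)] -/
theorem weakDuality_on {ν E ε₀ θ : ℝ} {f : UnitAddTorus (Fin 3) → EuclideanSpace ℝ (Fin 3)}
    {S : Set (Torus.energySpace (Fin 3))} {Φ : Torus.CylindricalTest (Fin 3)} (hθ : θ ≤ 0)
    (hfloor : ∀ u : Torus.energySpace (Fin 3), u ∈ S →
      Torus.eGradNormSq (u.1 : UnitAddTorus (Fin 3) → EuclideanSpace ℝ (Fin 3)) ≠ ⊤ → ‖u‖ ^ 2 ≤ E →
      ε₀ ≤ ν * (Torus.eGradNormSq (u.1 : UnitAddTorus (Fin 3) → EuclideanSpace ℝ (Fin 3))).toReal +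
        Torus.nsGeneratorPairing ν f u (Φ.grad u) +
        2 * θ * (Torus.pairing u.1 f -
          ν * (Torus.eGradNormSq (u.1 : UnitAddTorus (Fin 3) → EuclideanSpace ℝ (Fin 3))).toReal))
    {μ : Measure (Torus.energySpace (Fin 3))} [IsProbabilityMeasure μ] (hS : ∀ᵐ u ∂μ, u ∈ S)
    (hball : ∀ᵐ u ∂μ, ‖u‖ ^ 2 ≤ E) (hG : Torus.ensembleEnstrophy μ < ⊤)
    (hL : Integrable (fun u => Torus.nsGeneratorPairing ν f u (Φ.grad u)) μ ∧
      ∫ u, Torus.nsGeneratorPairing ν f u (Φ.grad u) ∂μ = 0)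
    (hW : Integrable (fun u : Torus.energySpace (Fin 3) => Torus.pairing u.1 f) μ)
    (hEI : Torus.ensembleDissipation ν μ ≤ ∫ u, Torus.pairing u.1 f ∂μ) :
    ε₀ ≤ Torus.ensembleDissipation ν μ := by
  have hmeas := (Torus.measurable_eGradNormSq_coe (d := Fin 3))
  set D : Torus.energySpace (Fin 3) → ℝ := fun u =>
    ν * (Torus.eGradNormSq (u.1 : UnitAddTorus (Fin 3) → EuclideanSpace ℝ (Fin 3))).toReal with hDdef
  have hDint : Integrable D μ :=
    (integrable_toReal_of_lintegral_ne_top hmeas.aemeasurable hG.ne).const_mul ν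
  have hDeq : ∫ u, D u ∂μ = Torus.ensembleDissipation ν μ := by
    rw [hDdef, integral_const_mul, Torus.ensembleDissipation, Torus.ensembleEnstrophy,
      integral_toReal hmeas.aemeasurable (ae_lt_top hmeas hG.ne)]
  have hAE : ∀ᵐ u ∂μ, ε₀ ≤ D u + Torus.nsGeneratorPairing ν f u (Φ.grad u) +
      2 * θ * (Torus.pairing u.1 f - D u) := by
    filter_upwards [hS, hball, ae_lt_top hmeas hG.ne] with u hu hb hfin
    exact hfloor u hu hfin.ne hb
  have hI : ∫ _ : Torus.energySpace (Fin 3), ε₀ ∂μ ≤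
      ∫ u, (D u + Torus.nsGeneratorPairing ν f u (Φ.grad u) + 2 * θ * (Torus.pairing u.1 f - D u)) ∂μ :=
    integral_mono_ae (integrable_const _) ((hDint.add hL.1).add ((hW.sub hDint).const_mul _)) hAE
  rw [integral_const, probReal_univ, one_smul,
    integral_add (f := fun u : Torus.energySpace (Fin 3) => D u + Torus.nsGeneratorPairing ν f u (Φ.grad u))
      (g := fun u : Torus.energySpace (Fin 3) => 2 * θ * (Torus.pairing u.1 f - D u)) (hDint.add hL.1)
      ((hW.sub hDint).const_mul _),
    integral_add hDint hL.1,
    integral_const_mul (2 * θ) (fun u : Torus.energySpace (Fin 3) => Torus.pairing u.1 f - D u),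
    integral_sub hW hDint, hL.2, hDeq] at hI
  have hchan : 2 * θ * ((∫ u, Torus.pairing u.1 f ∂μ) - Torus.ensembleDissipation ν μ) ≤ 0 := by
    have h1 : 0 ≤ (∫ u, Torus.pairing u.1 f ∂μ) - Torus.ensembleDissipation ν μ := by linarith
    nlinarith
  linarith

/-- **`MirrorFloorTG` ⇒ S3 (low-energy relaxed K-statistics of `f_TG` are loud)** — the registered stub
`stub_mirrorLawsLoudTG` of line `registered`, VERBATIM, follows from the crux by weak duality on the mirror
slab: the open stub is NECESSARY for the crux (and, with the landed S1a–S1c and S2, equivalent to it).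
[cite: RosaTemam2020, Thm 6.3–6.4] -/
theorem mirrorLawsLoudTG_of_mirrorFloorTG : Summit.AnomalousDissipation.AnomalousDissipation.Theses.PumpedMirror.MirrorFloorTG → ∀ f : UnitAddTorus (Fin 3) → EuclideanSpace ℝ (Fin 3), f = (fun x => !₂[(fourier 1 (x 0) : ℂ).im * (fourier 1 (x 1) : ℂ).re * (fourier 1 (x 2) : ℂ).re, -((fourier 1 (x 0) : ℂ).re * (fourier 1 (x 1) : ℂ).im * (fourier 1 (x 2) : ℂ).re), (0 : ℝ)]) → ∀ E : ℝ, 0 < E → ∃ ε₀ ν₀ : ℝ, 0 < ε₀ ∧ 0 < ν₀ ∧ ∀ ν : ℝ, 0 < ν → ν < ν₀ → ∀ μ : MeasureTheory.Measure (Literature.Analysis.FunctionSpaces.Torus.energySpace (Fin 3)), MeasureTheory.IsProbabilityMeasure μ → (∀ᵐ u ∂μ, ∀ i j : Fin 3, (fun x => (u.1 : UnitAddTorus (Fin 3) → EuclideanSpace ℝ (Fin 3)) (Function.update x i (-x i)) j) =ᵐ[MeasureTheory.volume] (fun x => if j = i then -((u.1 : UnitAddTorus (Fin 3) → EuclideanSpace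 ℝ (Fin 3)) x j) else (u.1 : UnitAddTorus (Fin 3) → EuclideanSpace ℝ (Fin 3)) x j)) → (∀ᵐ u ∂μ, ‖u‖ ^ 2 ≤ E) → Literature.Analysis.FluidPDE.Torus.ensembleEnstrophy μ < ⊤ → (∀ Φ : Literature.Analysis.FluidPDE.Torus.CylindricalTest (Fin 3), MeasureTheory.Integrable (fun u => Literature.Analysis.FluidPDE.Torus.nsGeneratorPairing ν f u (Φ.grad u)) μ ∧ ∫ u, Literature.Analysis.FluidPDE.Torus.nsGeneratorPairing ν f u (Φ.grad u) ∂μ = 0) → MeasureTheory.Integrable (fun u : Literature.Analysis.FunctionSpaces.Torus.energySpace (Fin 3) => Literature.Analysis.FluidPDE.Torus.pairing u.1 f) μ → Literature.Analysis.FluidPDE.Torus.ensembleDissipation ν μ ≤ ∫ u, Literature.Analysis.FluidPDE.Torus.pairing u.1 f ∂μ → ε₀ ≤ Literature.Analysis.FluidPDE.Torus.ensembleDissipation ν μ := by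
  intro hA f hf E hE
  obtain ⟨ε₀, ν₀, hε₀, hν₀, hfl⟩ := hA f hf E hE
  refine ⟨ε₀, ν₀, hε₀, hν₀, fun ν hν hνlt μ hP hsym hball hG hL hW hEI => ?_⟩
  obtain ⟨Φ, θ, hθ, hfloor⟩ := hfl ν hν hνlt
  exact weakDuality_on (S := {u : Torus.energySpace (Fin 3) | ∀ i j : Fin 3,
      (fun x => (u.1 : UnitAddTorus (Fin 3) → EuclideanSpace ℝ (Fin 3)) (Function.update x i (-x i)) j)
        =ᵐ[volume]
      (fun x => if j = i then -((u.1 : UnitAddTorus (Fin 3) → EuclideanSpace ℝ (Fin 3)) x j)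
        else (u.1 : UnitAddTorus (Fin 3) → EuclideanSpace ℝ (Fin 3)) x j)})
    hθ (fun u hu hfin hb => hfloor u hu hfin hb) hsym hball hG (hL Φ) hW hEI

end Summit.AnomalousDissipation.AnomalousDissipation.Theorems.PumpedMirrorMirrorFloorTG

end
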